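import Literature.Analysis.FluidPDE.PineauVicolGaussSobolev
import Literature.Analysis.FluidPDE.PineauVicolEnstrophyIdentity
import Literature.Analysis.FluidPDE.WholeSpaceIBPIntegrable

/-!
# Crux `SymmetricScarExists` (stmt-NavierStokesRegularity-11718), line `logtime-bernoulli-certificate`:
  lemmas for STUB 2 (`stub_gaussianWindowLaw`, the Gaussian window law), part 1

Helper file (lands `--supports stmt-NavierStokesRegularity-11718`) for the registered stub
`stub_gaussianWindowLaw` of the line's skeleton.  With the Ornstein–Uhlenbeck Gaussian
`g(y) = e^{−|y|²/4}` (`PineauVicol2026.gaussWeight`, `∇g = −½ y g`) on a finite-dimensional real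
inner product space `E` and a field `V` with the scale-invariant (Type I) bounds
`(1 + |y|)|V| ≤ A`, `|DV| ≤ B`, `|D²V| ≤ B`, every integrand of the Gaussian energy method is
`(bounded continuous) × g`, hence integrable (`integrable_of_norm_le_mul_gaussWeight` and its
corollaries, from the tree's `integrable_one_add_norm_pow_mul_exp_neg_mul_sq`), and the viscous
term integrates by parts on the whole space without boundary terms:

* `integral_inner_laplacian_mul_gaussWeight`: `∫ ⟨V, ΔV⟩ g = −∫ |DV|²_F g + ½ ∫ ⟨V, DV y⟩ g`
  (one integration by parts per coordinate direction, Mathlib's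
  `integral_bilinear_hasFDerivAt_right_eq_neg_left_of_integrable`; the second term is the
  commutator with the weight, `∂ᵢ g = −½ yᵢ g`).

Its `ℝ³` form is the registered sub-goal `stub_gaussianWindowLaw_laplacian` of the crux item; the
transport and pressure terms, the assembled slice identity and the window law itself are in the
companion file `…GaussianWindowLaw`.  Sources: the Gaussian-weighted energy identity in Leray's similarity
variables is Giga–Kohn's weighted energy method; with weight `e^{−|y|²/4}` and head pressure
`P + ½|U|²` it is the `U ≡ 0`-weight case of Pineau–Vicol 2026, (4.1), (7.7).  Everything here
is folklore calculus, fully proved.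
-/

noncomputable section

open MeasureTheory Set Function Filter Topology InnerProductSpace
open scoped RealInnerProductSpace Laplacian ContDiff
open Literature.Analysis.FluidPDE Literature.Analysis.FluidPDE.PineauVicol2026

namespace Summit.NavierStokesRegularity.NavierStokesRegularity.Theorems.SymmetricScarExists.LogtimeBernoulli

/-! ### Elementary consequences of the weighted bounds -/

section Elementary

variable {E : Type*} [NormedAddCommGroup E]

/-- `(1 + |y|)ⁿ a ≤ K` with `a ≥ 0` gives `a ≤ K` (the weight is `≥ 1`). [folklore] -/
theorem le_of_one_add_norm_pow_mul_le {y : E} {a K : ℝ} {n : ℕ} (ha : 0 ≤ a)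
    (h : (1 + ‖y‖) ^ n * a ≤ K) : a ≤ K :=
  (le_mul_of_one_le_left ha (one_le_pow₀ (by linarith [norm_nonneg y]))).trans h

/-- `(1 + |y|) a ≤ K` with `a ≥ 0` gives `a ≤ K`. [folklore] -/
theorem le_of_one_add_norm_mul_le {y : E} {a K : ℝ} (ha : 0 ≤ a) (h : (1 + ‖y‖) * a ≤ K) :
    a ≤ K :=
  (le_mul_of_one_le_left ha (by linarith [norm_nonneg y])).trans h

/-- `(1 + |y|) a ≤ K` with `a ≥ 0` gives `|y| a ≤ K`. [folklore] -/
theorem norm_mul_le_of_one_add_norm_mul_le {y : E} {a K : ℝ} (ha : 0 ≤ a)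
    (h : (1 + ‖y‖) * a ≤ K) : ‖y‖ * a ≤ K :=
  (mul_le_mul_of_nonneg_right (by linarith) ha).trans h

end Elementary

/-! ### Time lines of eternal smooth fields -/

section TimeLines

variable {X : Type*} [NormedAddCommGroup X] [NormedSpace ℝ X]
variable {F : Type*} [NormedAddCommGroup F] [NormedSpace ℝ F]

/-- Time lines `s ↦ w(s, x)` of a field jointly smooth on all of `ℝ × X` are continuous (they are
differentiable, `IsSmoothSpaceTimeOn.hasDerivAt_timeLine`). [folklore] -/
theorem continuous_timeLine {w : ℝ → X → F} (hw : IsSmoothSpaceTimeOn univ w) (x : X) :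
    Continuous fun s => w s x :=
  continuous_iff_continuousAt.2 fun s =>
    (hw.hasDerivAt_timeLine isOpen_univ (mem_univ s) x).continuousAt

end TimeLines

/-! ### Second derivatives in an orthonormal frame -/

section SecondDerivative

variable {E : Type*} [NormedAddCommGroup E] [InnerProductSpace ℝ E]
variable {F' : Type*} [NormedAddCommGroup F'] [NormedSpace ℝ F']

/-- `‖D²V(y)(bᵢ, bⱼ)‖ ≤ ‖D²V(y)‖` for vectors of an orthonormal basis, with the second
derivative measured by `iteratedFDeriv ℝ 2` (Mathlib `norm_iteratedFDeriv_fderiv`). [folklore] -/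
theorem norm_fderiv_fderiv_apply_le {ι : Type*} [Fintype ι] (b : OrthonormalBasis ι ℝ E)
    (V : E → F') (y : E) (i j : ι) :
    ‖fderiv ℝ (fderiv ℝ V) y (b i) (b j)‖ ≤ ‖iteratedFDeriv ℝ 2 V y‖ := by
  calc ‖fderiv ℝ (fderiv ℝ V) y (b i) (b j)‖ ≤ ‖fderiv ℝ (fderiv ℝ V) y (b i)‖ :=
        norm_apply_orthonormalBasis_le b j _
    _ ≤ ‖fderiv ℝ (fderiv ℝ V) y‖ := norm_apply_orthonormalBasis_le b i _
    _ = ‖iteratedFDeriv ℝ 2 V y‖ := by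
        rw [← norm_iteratedFDeriv_fderiv (n := 1), norm_iteratedFDeriv_one]

end SecondDerivative

/-! ### The Frobenius norm: a bound and continuity -/

section Frobenius

variable {E : Type*} [NormedAddCommGroup E] [InnerProductSpace ℝ E] [FiniteDimensional ℝ E]
variable {F' : Type*} [NormedAddCommGroup F'] [InnerProductSpace ℝ F']

/-- `|L|²_F ≤ dim E · ‖L‖²` (each `‖L bᵢ‖ ≤ ‖L‖`). [folklore] -/
theorem frobeniusNormSq_le_finrank_mul (L : E →L[ℝ] F') :
    frobeniusNormSq L ≤ Module.finrank ℝ E * ‖L‖ ^ 2 := by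
  unfold frobeniusNormSq
  calc ∑ i, ‖L (stdOrthonormalBasis ℝ E i)‖ ^ 2
      ≤ ∑ _i : Fin (Module.finrank ℝ E), ‖L‖ ^ 2 := Finset.sum_le_sum fun i _ =>
        pow_le_pow_left₀ (norm_nonneg _) (norm_apply_orthonormalBasis_le _ i L) 2
    _ = Module.finrank ℝ E * ‖L‖ ^ 2 := by simp

/-- The Frobenius norm squared is a continuous function of the linear map. [folklore] -/
theorem continuous_frobeniusNormSq : Continuous fun L : E →L[ℝ] F' => frobeniusNormSq L := by
  unfold frobeniusNormSq
  exact continuous_finsetSum _ fun i _ =>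
    ((ContinuousLinearMap.apply ℝ F' (stdOrthonormalBasis ℝ E i)).continuous.norm.pow 2)

/-- `div (g V) = −½ (y·V) g` for a divergence-free `C¹` field. [folklore] -/
theorem divergence_gaussWeight_smul {V : E → E} (hV : ContDiff ℝ 1 V)
    (hdiv : VectorCalculus.IsDivFree V) (y : E) :
    VectorCalculus.divergence (fun z => gaussWeight z • V z) y =
      -(1 / 2 : ℝ) * ⟪y, V y⟫ * gaussWeight y := by
  rw [divergence_smul_apply ((contDiff_gaussWeight (n := 1)).differentiable one_ne_zero y)
    (hV.differentiable one_ne_zero y), hdiv y, gradient_gaussWeight, real_inner_smul_right,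
    real_inner_comm]
  ring

end Frobenius

/-! ### Integrability against the Gaussian -/

section Integrable

variable {E : Type*} [NormedAddCommGroup E] [InnerProductSpace ℝ E] [FiniteDimensional ℝ E]
  [MeasurableSpace E] [BorelSpace E]

/-- **(Bounded) × Gaussian is integrable**: a strongly measurable `f` with
`‖f y‖ ≤ M (1 + |y|)ᴺ g(y)` is integrable (the tree's
`integrable_one_add_norm_pow_mul_exp_neg_mul_sq`). [folklore] -/
theorem integrable_of_norm_le_mul_gaussWeight {G : Type*} [NormedAddCommGroup G] {f : E → G}
    (hf : AEStronglyMeasurable f volume) {M : ℝ} (N : ℕ)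
    (h : ∀ y, ‖f y‖ ≤ M * (1 + ‖y‖) ^ N * gaussWeight y) : Integrable f := by
  have hg := (integrable_one_add_norm_pow_mul_exp_neg_mul_sq (E := E) (c := 1 / 4)
    (by norm_num) N).const_mul M
  refine hg.mono' hf (Eventually.of_forall fun y => ?_)
  calc ‖f y‖ ≤ M * (1 + ‖y‖) ^ N * gaussWeight y := h y
    _ = M * ((1 + ‖y‖) ^ N * Real.exp (-(1 / 4 : ℝ) * ‖y‖ ^ 2)) := by
        rw [gaussWeight_eq, mul_assoc]

/-- The case `N = 0`: `‖f y‖ ≤ M g(y)` gives integrability. [folklore] -/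
theorem integrable_of_norm_le_const_mul_gaussWeight {G : Type*} [NormedAddCommGroup G]
    {f : E → G} (hf : AEStronglyMeasurable f volume) {M : ℝ}
    (h : ∀ y, ‖f y‖ ≤ M * gaussWeight y) : Integrable f :=
  integrable_of_norm_le_mul_gaussWeight hf 0 fun y => by simpa using h y

/-- `⟨V, W⟩ g` is integrable for bounded continuous fields `V`, `W`. [folklore] -/
theorem integrable_inner_mul_gaussWeight {F' : Type*} [NormedAddCommGroup F']
    [InnerProductSpace ℝ F'] {V W : E → F'} (cV : Continuous V) (cW : Continuous W) {A B : ℝ}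
    (hA : ∀ y, ‖V y‖ ≤ A) (hB : ∀ y, ‖W y‖ ≤ B) :
    Integrable fun y => ⟪V y, W y⟫ * gaussWeight y := by
  refine integrable_of_norm_le_const_mul_gaussWeight (M := A * B)
    ((cV.inner cW).mul continuous_gaussWeight).aestronglyMeasurable fun y => ?_
  rw [norm_mul, Real.norm_of_nonneg (gaussWeight_pos y).le]
  exact mul_le_mul_of_nonneg_right ((norm_inner_le_norm _ _).trans
    (mul_le_mul (hA y) (hB y) (norm_nonneg _) ((norm_nonneg _).trans (hA y))))
    (gaussWeight_pos y).le

/-- `|V|² g` is integrable for a bounded continuous field. [folklore] -/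
theorem integrable_norm_sq_mul_gaussWeight' {F' : Type*} [NormedAddCommGroup F'] {V : E → F'}
    (cV : Continuous V) {A : ℝ} (hA : ∀ y, ‖V y‖ ≤ A) :
    Integrable fun y => ‖V y‖ ^ 2 * gaussWeight y := by
  refine integrable_of_norm_le_const_mul_gaussWeight (M := A ^ 2)
    ((cV.norm.pow 2).mul continuous_gaussWeight).aestronglyMeasurable fun y => ?_
  rw [norm_mul, Real.norm_of_nonneg (gaussWeight_pos y).le, Real.norm_of_nonneg (sq_nonneg _)]
  exact mul_le_mul_of_nonneg_right (pow_le_pow_left₀ (norm_nonneg _) (hA y) 2)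
    (gaussWeight_pos y).le

/-- `f (y·V) g` is integrable for bounded continuous `f` and continuous `V` with `|y||V| ≤ A`
(the linear weight `y` is absorbed by the decay of `V`). [folklore] -/
theorem integrable_mul_inner_id_mul_gaussWeight {f : E → ℝ} {V : E → E} (cf : Continuous f)
    (cV : Continuous V) {A B : ℝ} (hf : ∀ y, |f y| ≤ B) (hyA : ∀ y, ‖y‖ * ‖V y‖ ≤ A) :
    Integrable fun y => f y * ⟪y, V y⟫ * gaussWeight y := by
  refine integrable_of_norm_le_const_mul_gaussWeight (M := B * A)
    (((cf.mul (continuous_id.inner cV)).mul continuous_gaussWeight).aestronglyMeasurable)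
    fun y => ?_
  rw [norm_mul, norm_mul, Real.norm_of_nonneg (gaussWeight_pos y).le, Real.norm_eq_abs,
    Real.norm_eq_abs]
  exact mul_le_mul_of_nonneg_right (mul_le_mul (hf y) ((abs_real_inner_le_norm _ _).trans (hyA y))
    (abs_nonneg _) ((abs_nonneg _).trans (hf y))) (gaussWeight_pos y).le

/-- `⟨V, DV y⟩ g` is integrable for `V ∈ C¹` with `|y||V| ≤ A`, `|DV| ≤ B`. [folklore] -/
theorem integrable_inner_fderiv_apply_id_mul_gaussWeight {V : E → E} (hV : ContDiff ℝ 1 V)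
    {A B : ℝ} (hyA : ∀ y, ‖y‖ * ‖V y‖ ≤ A) (h1 : ∀ y, ‖fderiv ℝ V y‖ ≤ B) :
    Integrable fun y => ⟪V y, fderiv ℝ V y y⟫ * gaussWeight y := by
  have hB0 : 0 ≤ B := (norm_nonneg _).trans (h1 0)
  refine integrable_of_norm_le_const_mul_gaussWeight (M := A * B)
    (((hV.continuous.inner ((hV.continuous_fderiv one_ne_zero).clm_apply continuous_id)).mul
      continuous_gaussWeight).aestronglyMeasurable) fun y => ?_
  rw [norm_mul, Real.norm_of_nonneg (gaussWeight_pos y).le]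
  refine mul_le_mul_of_nonneg_right ((norm_inner_le_norm _ _).trans ?_) (gaussWeight_pos y).le
  calc ‖V y‖ * ‖fderiv ℝ V y y‖ ≤ ‖V y‖ * (B * ‖y‖) :=
        mul_le_mul_of_nonneg_left ((ContinuousLinearMap.le_opNorm _ _).trans
          (mul_le_mul_of_nonneg_right (h1 y) (norm_nonneg _))) (norm_nonneg _)
    _ = ‖y‖ * ‖V y‖ * B := by ring
    _ ≤ A * B := mul_le_mul_of_nonneg_right (hyA y) hB0

end Integrable

/-! ### Integrations by parts against the Gaussian weight -/

section IBP

variable {E : Type*} [NormedAddCommGroup E] [InnerProductSpace ℝ E] [FiniteDimensional ℝ E]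
  [MeasurableSpace E] [BorelSpace E]

/-- **The Laplacian against the Gaussian weight.** For `V ∈ C²` with `(1 + |y|)|V| ≤ A`,
`|DV| ≤ B`, `|D²V| ≤ B`:
`∫ ⟨V, ΔV⟩ g = −∫ |DV|²_F g + ½ ∫ ⟨V, DV y⟩ g`
(integrate by parts once in each coordinate direction; `∂ᵢ(g V) = g ∂ᵢV − ½ yᵢ g V`). [folklore] -/
theorem integral_inner_laplacian_mul_gaussWeight {V : E → E} (hV : ContDiff ℝ 2 V) {A B : ℝ}
    (h0 : ∀ y, (1 + ‖y‖) * ‖V y‖ ≤ A) (h1 : ∀ y, ‖fderiv ℝ V y‖ ≤ B)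
    (h2 : ∀ y, ‖iteratedFDeriv ℝ 2 V y‖ ≤ B) :
    ∫ y, ⟪V y, (Δ V) y⟫ * gaussWeight y =
      -(∫ y, frobeniusNormSq (fderiv ℝ V y) * gaussWeight y) +
        (1 / 2 : ℝ) * ∫ y, ⟪V y, fderiv ℝ V y y⟫ * gaussWeight y := by
  set b := stdOrthonormalBasis ℝ E with hb_def
  have hV1 : ContDiff ℝ 1 V := hV.of_le one_le_two
  have hD : ContDiff ℝ 1 (fderiv ℝ V) := hV.fderiv_right (m := 1) le_rfl
  have hA : ∀ y, ‖V y‖ ≤ A := fun y => le_of_one_add_norm_mul_le (norm_nonneg _) (h0 y)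
  have hyA : ∀ y, ‖y‖ * ‖V y‖ ≤ A := fun y =>
    norm_mul_le_of_one_add_norm_mul_le (norm_nonneg _) (h0 y)
  have hA0 : 0 ≤ A := (norm_nonneg _).trans (hA 0)
  have hB0 : 0 ≤ B := (norm_nonneg _).trans (h1 0)
  have hg0 : ∀ y : E, 0 ≤ gaussWeight y := fun y => (gaussWeight_pos y).le
  -- continuity
  have cV : Continuous V := hV.continuous
  have cDV : Continuous (fderiv ℝ V) := hV.continuous_fderiv two_ne_zero
  have cD2 : Continuous (fderiv ℝ (fderiv ℝ V)) := hD.continuous_fderiv one_ne_zero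
  have cg : Continuous (gaussWeight : E → ℝ) := continuous_gaussWeight
  -- derivatives of the two factors
  have hf : ∀ y, HasFDerivAt (fun z => gaussWeight z • V z)
      (gaussWeight y • fderiv ℝ V y + (fderiv ℝ gaussWeight y).smulRight (V y)) y := fun y =>
    ((contDiff_gaussWeight (n := 1)).differentiable one_ne_zero y).hasFDerivAt.smul
      (hV1.differentiable one_ne_zero y).hasFDerivAt
  have hg : ∀ i y, HasFDerivAt (fun z => fderiv ℝ V z (b i))
      ((ContinuousLinearMap.apply ℝ E (b i)).comp (fderiv ℝ (fderiv ℝ V) y)) y := fun i y =>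
    (ContinuousLinearMap.apply ℝ E (b i)).hasFDerivAt.comp y (hD.differentiable one_ne_zero y).hasFDerivAt
  -- pointwise bounds on the pieces
  have hDi : ∀ i y, ‖fderiv ℝ V y (b i)‖ ≤ B := fun i y =>
    (norm_apply_orthonormalBasis_le b i _).trans (h1 y)
  have hD2i : ∀ i y, ‖fderiv ℝ (fderiv ℝ V) y (b i) (b i)‖ ≤ B := fun i y =>
    (norm_fderiv_fderiv_apply_le b V y i i).trans (h2 y)
  have hdg : ∀ i y, ‖fderiv ℝ gaussWeight y (b i) • V y‖ ≤ (1 / 2 : ℝ) * A * gaussWeight y := by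
    intro i y
    rw [fderiv_gaussWeight_apply, norm_smul, Real.norm_eq_abs, abs_mul, abs_mul,
      abs_of_nonneg (hg0 y), show |(-(1 / 2 : ℝ))| = 1 / 2 by norm_num]
    have hgy := hg0 y
    have e1 : |⟪y, b i⟫| ≤ ‖y‖ := by
      rw [real_inner_comm]; exact abs_inner_orthonormalBasis_le b i y
    calc 1 / 2 * gaussWeight y * |⟪y, b i⟫| * ‖V y‖
        = 1 / 2 * gaussWeight y * (|⟪y, b i⟫| * ‖V y‖) := by ring
      _ ≤ 1 / 2 * gaussWeight y * (‖y‖ * ‖V y‖) :=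
          mul_le_mul_of_nonneg_left (mul_le_mul_of_nonneg_right e1 (norm_nonneg _)) (by positivity)
      _ ≤ 1 / 2 * gaussWeight y * A := mul_le_mul_of_nonneg_left (hyA y) (by positivity)
      _ = (1 / 2 : ℝ) * A * gaussWeight y := by ring
  -- integrability of the three products, coordinate by coordinate
  have I1 : ∀ i, Integrable (fun y => ⟪gaussWeight y • fderiv ℝ V y (b i) +
      fderiv ℝ gaussWeight y (b i) • V y, fderiv ℝ V y (b i)⟫) := by
    intro i
    refine integrable_of_norm_le_const_mul_gaussWeight (M := (B + (1 / 2 : ℝ) * A) * B) ?_ ?_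
    · exact (((cg.smul (cDV.clm_apply continuous_const)).add
        (((contDiff_gaussWeight (n := 1)).continuous_fderiv one_ne_zero).clm_apply
          continuous_const |>.smul cV)).inner (cDV.clm_apply continuous_const)).aestronglyMeasurable
    · intro y
      have hgy := hg0 y
      refine (norm_inner_le_norm _ _).trans ?_
      have e1 : ‖gaussWeight y • fderiv ℝ V y (b i) + fderiv ℝ gaussWeight y (b i) • V y‖ ≤
          (B + (1 / 2 : ℝ) * A) * gaussWeight y := by
        refine (norm_add_le _ _).trans ?_
        rw [norm_smul, Real.norm_of_nonneg (hg0 y)]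
        calc gaussWeight y * ‖fderiv ℝ V y (b i)‖ + ‖fderiv ℝ gaussWeight y (b i) • V y‖
            ≤ gaussWeight y * B + (1 / 2 : ℝ) * A * gaussWeight y :=
              add_le_add (mul_le_mul_of_nonneg_left (hDi i y) (hg0 y)) (hdg i y)
          _ = (B + (1 / 2 : ℝ) * A) * gaussWeight y := by ring
      calc ‖gaussWeight y • fderiv ℝ V y (b i) + fderiv ℝ gaussWeight y (b i) • V y‖ *
            ‖fderiv ℝ V y (b i)‖
          ≤ (B + (1 / 2 : ℝ) * A) * gaussWeight y * B :=
            mul_le_mul e1 (hDi i y) (norm_nonneg _) (by positivity)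
        _ = (B + (1 / 2 : ℝ) * A) * B * gaussWeight y := by ring
  have I2 : ∀ i, Integrable (fun y => ⟪gaussWeight y • V y, fderiv ℝ (fderiv ℝ V) y (b i) (b i)⟫) :=
    fun i => (integrable_inner_mul_gaussWeight cV ((cD2.clm_apply continuous_const).clm_apply
      continuous_const) hA (hD2i i)).congr (Eventually.of_forall fun y => by
        simp only; rw [real_inner_smul_left, mul_comm])
  have I3 : ∀ i, Integrable (fun y => ⟪gaussWeight y • V y, fderiv ℝ V y (b i)⟫) :=
    fun i => (integrable_inner_mul_gaussWeight cV (cDV.clm_apply continuous_const) hA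
      (hDi i)).congr (Eventually.of_forall fun y => by simp only; rw [real_inner_smul_left, mul_comm])
  -- integration by parts in the direction `b i`
  have hibp : ∀ i, ∫ y, ⟪gaussWeight y • V y, fderiv ℝ (fderiv ℝ V) y (b i) (b i)⟫ =
      -∫ y, ⟪gaussWeight y • fderiv ℝ V y (b i) + fderiv ℝ gaussWeight y (b i) • V y,
        fderiv ℝ V y (b i)⟫ := by
    intro i
    have H := integral_bilinear_hasFDerivAt_right_eq_neg_left_of_integrable
      (μ := (volume : Measure E)) (f := fun z => gaussWeight z • V z)
      (f' := fun y => gaussWeight y • fderiv ℝ V y + (fderiv ℝ gaussWeight y).smulRight (V y))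
      (g := fun z => fderiv ℝ V z (b i))
      (g' := fun y => (ContinuousLinearMap.apply ℝ E (b i)).comp (fderiv ℝ (fderiv ℝ V) y))
      (v := b i) (B := innerSL ℝ) (I1 i) (I2 i) (I3 i) (fun y _ => hf y) (fun y _ => hg i y)
    exact H
  -- the two sums on the right
  have J1 : ∀ i, Integrable (fun y => ‖fderiv ℝ V y (b i)‖ ^ 2 * gaussWeight y) := fun i =>
    integrable_norm_sq_mul_gaussWeight' (cDV.clm_apply continuous_const) (hDi i)
  have J2 : ∀ i, Integrable (fun y => ⟪y, b i⟫ * ⟪V y, fderiv ℝ V y (b i)⟫ * gaussWeight y) := by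
    intro i
    refine integrable_of_norm_le_const_mul_gaussWeight (M := A * B) ?_ ?_
    · exact (((continuous_id.inner continuous_const).mul
        (cV.inner (cDV.clm_apply continuous_const))).mul cg).aestronglyMeasurable
    · intro y
      rw [norm_mul, norm_mul, Real.norm_of_nonneg (hg0 y), Real.norm_eq_abs, Real.norm_eq_abs]
      have e1 : |⟪y, b i⟫| ≤ ‖y‖ := by
        rw [real_inner_comm]; exact abs_inner_orthonormalBasis_le b i y
      have e2 : |⟪V y, fderiv ℝ V y (b i)⟫| ≤ ‖V y‖ * B :=
        (abs_real_inner_le_norm _ _).trans (mul_le_mul_of_nonneg_left (hDi i y) (norm_nonneg _))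
      have hgy := hg0 y
      calc |⟪y, b i⟫| * |⟪V y, fderiv ℝ V y (b i)⟫| * gaussWeight y
          ≤ ‖y‖ * (‖V y‖ * B) * gaussWeight y :=
            mul_le_mul_of_nonneg_right (mul_le_mul e1 e2 (abs_nonneg _) (norm_nonneg _)) hgy
        _ = ‖y‖ * ‖V y‖ * B * gaussWeight y := by ring
        _ ≤ A * B * gaussWeight y :=
            mul_le_mul_of_nonneg_right (mul_le_mul_of_nonneg_right (hyA y) hB0) hgy
  -- assemble: left-hand side
  have eL : ∀ y, ⟪V y, (Δ V) y⟫ * gaussWeight y =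
      ∑ i, ⟪gaussWeight y • V y, fderiv ℝ (fderiv ℝ V) y (b i) (b i)⟫ := by
    intro y
    rw [laplacian_apply_eq_sum_fderiv_fderiv b V y, ← inner_sum, real_inner_smul_left, mul_comm]
  -- right-hand side, pointwise
  have eR : ∀ i y, ⟪gaussWeight y • fderiv ℝ V y (b i) + fderiv ℝ gaussWeight y (b i) • V y,
      fderiv ℝ V y (b i)⟫ =
      ‖fderiv ℝ V y (b i)‖ ^ 2 * gaussWeight y +
        (-(1 / 2 : ℝ)) * (⟪y, b i⟫ * ⟪V y, fderiv ℝ V y (b i)⟫ * gaussWeight y) := by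
    intro i y
    rw [inner_add_left, real_inner_smul_left, real_inner_smul_left, real_inner_self_eq_norm_sq,
      fderiv_gaussWeight_apply]
    ring
  have eY : ∀ y, ∑ i, ⟪y, b i⟫ * ⟪V y, fderiv ℝ V y (b i)⟫ * gaussWeight y =
      ⟪V y, fderiv ℝ V y y⟫ * gaussWeight y := by
    intro y
    have e : fderiv ℝ V y (∑ i, ⟪b i, y⟫ • b i) = ∑ i, ⟪b i, y⟫ • fderiv ℝ V y (b i) := by
      rw [map_sum]
      exact Finset.sum_congr rfl fun i _ => by rw [map_smul]
    rw [b.sum_repr' y] at e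
    rw [e, inner_sum, Finset.sum_mul]
    refine Finset.sum_congr rfl fun i _ => ?_
    rw [real_inner_smul_right, real_inner_comm (b i)]
  calc ∫ y, ⟪V y, (Δ V) y⟫ * gaussWeight y
      = ∫ y, ∑ i, ⟪gaussWeight y • V y, fderiv ℝ (fderiv ℝ V) y (b i) (b i)⟫ :=
        integral_congr_ae (Eventually.of_forall eL)
    _ = ∑ i, ∫ y, ⟪gaussWeight y • V y, fderiv ℝ (fderiv ℝ V) y (b i) (b i)⟫ :=
        integral_finsetSum _ fun i _ => I2 i
    _ = -∑ i, ((∫ y, ‖fderiv ℝ V y (b i)‖ ^ 2 * gaussWeight y) +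
          (-(1 / 2 : ℝ)) * ∫ y, ⟪y, b i⟫ * ⟪V y, fderiv ℝ V y (b i)⟫ * gaussWeight y) := by
        rw [← Finset.sum_neg_distrib]
        refine Finset.sum_congr rfl fun i _ => ?_
        rw [hibp i]
        congr 1
        simp_rw [eR i]
        rw [integral_add (J1 i) ((J2 i).const_mul _), integral_const_mul]
    _ = -(∫ y, frobeniusNormSq (fderiv ℝ V y) * gaussWeight y) +
          (1 / 2 : ℝ) * ∫ y, ⟪V y, fderiv ℝ V y y⟫ * gaussWeight y := by
        rw [Finset.sum_add_distrib, ← Finset.mul_sum, ← integral_finsetSum _ fun i _ => J1 i,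
          ← integral_finsetSum _ fun i _ => J2 i]
        simp_rw [eY, ← Finset.sum_mul]
        simp only [frobeniusNormSq, hb_def]
        ring

/-- **Registered sub-goal `stub_gaussianWindowLaw_laplacian`** of STUB 2 (the viscous term of the
Gaussian window law on `ℝ³`): for `V ∈ C²(ℝ³; ℝ³)` with `(1 + |y|)|V| ≤ A`, `|DV| ≤ B`, `|D²V| ≤ B`,
`∫ ⟨V, ΔV⟩ g = −∫ |DV|²_F g + ½ ∫ ⟨V, DV y⟩ g` (`integral_inner_laplacian_mul_gaussWeight`). [folklore] -/
theorem stub_gaussianWindowLaw_laplacian :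
    ∀ (A B : ℝ) (V : EuclideanSpace ℝ (Fin 3) → EuclideanSpace ℝ (Fin 3)), ContDiff ℝ 2 V → (∀ y : EuclideanSpace ℝ (Fin 3), (1 + ‖y‖) * ‖V y‖ ≤ A) → (∀ y : EuclideanSpace ℝ (Fin 3), ‖fderiv ℝ V y‖ ≤ B) → (∀ y : EuclideanSpace ℝ (Fin 3), ‖iteratedFDeriv ℝ 2 V y‖ ≤ B) → (∫ y : EuclideanSpace ℝ (Fin 3), inner ℝ (V y) (Laplacian.laplacian V y) * Literature.Analysis.FluidPDE.PineauVicol2026.gaussWeight y) = -(∫ y : EuclideanSpace ℝ (Fin 3), Literature.Analysis.FluidPDE.frobeniusNormSq (fderiv ℝ V y) * Literature.Analysis.FluidPDE.PineauVicol2026.gaussWeight y) + (1 / 2 : ℝ) * (∫ y : EuclideanSpace ℝ (Fin 3), inner ℝ (V y) (fderiv ℝ V y y) * Literature.Analysis.FluidPDE.PineauVicol2026.gaussWeight y) :=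
  fun _ _ _ hV h0 h1 h2 => integral_inner_laplacian_mul_gaussWeight hV h0 h1 h2

end IBP

end Summit.NavierStokesRegularity.NavierStokesRegularity.Theorems.SymmetricScarExists.LogtimeBernoulli

end
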